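import Mathlib
import Literature.NumberTheory.LFunctions.Zhang2022.TypedSection15AIdentities
import Literature.NumberTheory.LFunctions.Zhang2022.Section8ResidueEdgeEngine
import Literature.NumberTheory.LFunctions.Zhang2022.Section17Eq171Edges
import Literature.NumberTheory.LFunctions.Zhang2022.Section4Prop22Eventually
import Literature.NumberTheory.LFunctions.Zhang2022.Section16I3plusShift
import HarnessLib

/-!
# Zhang (2022) §15 p. 80, `Z22:§15.u002` and (15.3): "Similar to (8.1), for `ψ ∈ Ψ₁` we have
# `Σ_{ρ∈𝔷(ψ)} 𝔨₁*(ρ,ψ)ω(ρ) = I₂⁺(ψ) − I₂⁻(ψ) + O(ε)`" — kernel-checked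

Topic `Literature/NumberTheory/LFunctions/Zhang2022` (Landau–Siegel audit tree; verdict-neutral).
Y. Zhang, *Discrete mean estimates and the Landau–Siegel zero*, arXiv:2211.02515v1 (2022)
[Zhang2022LandauSiegel] — **an unrefereed manuscript under adjudication**; nothing here asserts or
denies its Theorems 1–2. DAG node `Z22:§15.u002` [Z22 p.80, tex L3994–L4005]:

> "`𝔨₁(s,ψ) = Z(s,χψ)⁻¹ (L(s+β₁,ψ)L(s+β₂,ψ)/L(s,ψ)) B(s,ψ)K(1−s−β₃,ψ̄)`. Similar to (8.1), for `ψ ∈ Ψ₁`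
> we have `Σ_{ρ∈𝔷(ψ)} 𝔨₁*(ρ,ψ)ω(ρ) = I₂⁺(ψ) − I₂⁻(ψ) + O(ε)` with
> `I₂^±(ψ) = (1/2πi)∫_{𝔍(±α)} 𝔨₁(s,ψ)ω(s) ds`. Hence [(15.3)] `Φ₁ = Σ_{ψ∈Ψ₁}(I₂⁺(ψ) − I₂⁻(ψ)) + O(ε)`."

The typed node is `Typed.Section15A.Step15_u002 c′` (L4-t3); the edge `eq15_3_of_u002` to the typed
(15.3) `Typed.Section15A.Eq15_3 c′` is already in the tree (`TypedSection15AIdentities`). This file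
DISCHARGES the node by instantiating the tree's abstract (8.1) engine
(`Section8aStatements.lratio_residue_edge_of_prop22`, file `Section8ResidueEdgeEngine`) at
`G(s) = Z(s,χψ)⁻¹L(s+β₂,ψ)B(s,ψ)K(1−s−β₃,ψ̄)` — holomorphic on `{Im s > 0}` (`Z(·,χψ)⁻¹` is, for the
primitive `χψ (mod Dp)`; `L(·,ψ)`, `B`, `K` are entire — `Typed.Section17.differentiable_Bpoly`,
`Step16u010.differentiable_Kchar`) and of size `≤ e^{9𝓛⁹}` on the boundary zone
(`|Z(s,χψ)|⁻¹ ≤ e⁸` near the line, the convexity/Stirling bound for `L(s+β₂,ψ)`, trivial bounds for the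
Dirichlet polynomials `B`, `K`): so `𝔨₁ω = (L(s+β₁)/L(s))Gω` and `𝔨₁*(ρ)ω(ρ) = (L(ρ+β₁)/L′(ρ))G(ρ)ω(ρ)`.

Main results: `step15_u002_of_prop22 : 0 ≤ c′ → Skeleton.Prop22 c′ → Step15_u002 c′`;
`step15_u002_eventually`, `eq15_3_eventually` (from `Skeleton.prop22_eventually`): the two nodes
hold for every `c′ ≥ c₀`. No new definitions, no named facts. ZHANG-L discharge lane (strike seat
zl-closer-1), helpers under leaf `Typed.Section15A.Eq15_6` of `Skeleton.theorem1_of_leaves_v19`.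
WHAT THIS IS NOT: a claim about (15.4)–(15.6), Proposition 14.1, Theorems 1–2 of the source, or
Landau–Siegel zeros.

## References

* Y. Zhang, arXiv:2211.02515v1 (2022), §15 p. 80 (tex L3994–L4007); §8 (8.1) p. 42; §2 (2.5),
  (2.13). [cite: Zhang2022LandauSiegel, §15 (15.3) p. 80]
-/

noncomputable section

open Complex Real Set

namespace Literature.NumberTheory.LFunctions.Zhang2022.Typed.Section15A

open Literature.NumberTheory.LFunctions.Zhang2022 Skeleton
open Literature.NumberTheory.LFunctions.Zhang2022.Section8aStatements

/-! ### A. The trivial bound of `K(w,ψ̄)` (holomorphy: `Step16u010.differentiable_Kchar`) -/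

section KPoly

variable {D : ℕ}

/-- `|g*(y)| ≤ 1`. [cite: Zhang2022LandauSiegel, §6 p. 30; §4 (4.1)] -/
private theorem norm_gstar_le_one'' (hℓ : 0 < ell D) (y : ℝ) : ‖(gstar D y : ℂ)‖ ≤ 1 := by
  rw [Complex.norm_real, Real.norm_eq_abs, gstar]
  split_ifs
  · have h30 : 0 < ell D ^ 30 := by positivity
    rw [gW, abs_of_pos (GaussWeight.gWeight_pos h30 _)]
    exact (GaussWeight.gWeight_lt_one h30 _).le
  · simp

/-- **`|K(w,ψ̄)| ≤ 2Pt₀ + 1`** for `Re w ≥ 0`, `𝓛 > 0`: `< 2P₄ ≤ 2Pt₀` terms of modulus `≤ 1`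
(`P₄ = PT⁻²t₀ ≤ Pt₀`). [cite: Zhang2022LandauSiegel, §6 Lemma 6.1] -/
theorem norm_Kchar_psiBar_le (x : Chr D) (hℓ : 0 < ell D) {w : ℂ} (hw : 0 ≤ w.re) :
    ‖Kchar D (psiBarFn x) w‖ ≤ 2 * bigP D * t0 D + 1 := by
  rw [Kchar]
  have hterm : ∀ n ∈ Finset.Ico 1 ⌈2 * P4 D⌉₊,
      ‖psiBarFn x n * (n : ℂ) ^ (-w) * (gstar D (P4 D / n) : ℂ)‖ ≤ 1 := by
    intro n hn
    have hn : 0 < n := (Finset.mem_Ico.mp hn).1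
    rw [norm_mul, norm_mul]
    have h1 : ‖psiBarFn x n‖ ≤ 1 := by
      rw [psiBarFn, Complex.norm_conj]; exact x.ψ.norm_le_one _
    have h2 : ‖(n : ℂ) ^ (-w)‖ ≤ 1 := by
      rw [Complex.norm_natCast_cpow_of_pos hn]
      exact Real.rpow_le_one_of_one_le_of_nonpos (by exact_mod_cast hn) (by simpa using hw)
    have h3 := norm_gstar_le_one'' hℓ (P4 D / n)
    calc ‖psiBarFn x n‖ * ‖(n : ℂ) ^ (-w)‖ * ‖(gstar D (P4 D / n) : ℂ)‖ ≤ 1 * 1 * 1 := by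
          gcongr
      _ = 1 := by ring
  have hP4 : 0 ≤ P4 D := by
    rw [P4, bigP, t0]; exact mul_nonneg (div_nonneg (Real.exp_pos _).le (pow_nonneg (Real.exp_pos _).le _))
      (pow_nonneg hℓ.le _)
  have hP4le : P4 D ≤ bigP D * t0 D := by
    rw [P4]
    have hT : 1 ≤ bigT D ^ 2 :=
      one_le_pow₀ (by rw [bigT]; exact Real.one_le_exp (Real.rpow_nonneg (Real.log_natCast_nonneg D) _))
    have hP : 0 ≤ bigP D := (Real.exp_pos _).le
    exact mul_le_mul_of_nonneg_right (div_le_self hP hT) (pow_nonneg hℓ.le _)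
  calc ‖∑ n ∈ Finset.Ico 1 ⌈2 * P4 D⌉₊, psiBarFn x n * (n : ℂ) ^ (-w) * (gstar D (P4 D / n) : ℂ)‖
      ≤ ∑ n ∈ Finset.Ico 1 ⌈2 * P4 D⌉₊, ‖psiBarFn x n * (n : ℂ) ^ (-w) * (gstar D (P4 D / n) : ℂ)‖ :=
        norm_sum_le _ _
    _ ≤ ∑ n ∈ Finset.Ico 1 ⌈2 * P4 D⌉₊, (1 : ℝ) := Finset.sum_le_sum hterm
    _ = ((Finset.Ico 1 ⌈2 * P4 D⌉₊).card : ℝ) := by simp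
    _ ≤ 2 * P4 D + 1 := by
        rw [Nat.card_Ico]
        have h1 : ((⌈2 * P4 D⌉₊ - 1 : ℕ) : ℝ) ≤ (⌈2 * P4 D⌉₊ : ℝ) := by exact_mod_cast Nat.sub_le _ _
        have h2 : (⌈2 * P4 D⌉₊ : ℝ) < 2 * P4 D + 1 := Nat.ceil_lt_add_one (by positivity)
        linarith
    _ ≤ 2 * bigP D * t0 D + 1 := by nlinarith

end KPoly

/-! ### B. Sizes on the boundary zone: `Z(s,χψ)⁻¹`, `L(s+β₂,ψ)`, and the bookkeeping -/

section Sizes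

variable {D : ℕ}

/-- `p < 2P` on the window `p ∼ P`. [cite: Zhang2022LandauSiegel, §2 p. 4] -/
private theorem p_lt_two_bigP (x : Chr D) (hL : 1 ≤ ell D) : (x.p : ℝ) < 2 * bigP D := by
  have hm := x.mem
  rw [primeWindow, Finset.mem_filter, Finset.mem_Ioo] at hm
  have hP : 0 ≤ bigP D := (Real.exp_pos _).le
  have h1 : (x.p : ℝ) < bigP D * (1 + (ell D ^ 68)⁻¹) := Nat.lt_ceil.mp hm.1.2
  have h68 : (ell D ^ 68)⁻¹ ≤ 1 := inv_le_one_of_one_le₀ (one_le_pow₀ hL)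
  nlinarith

/-- `𝓛^k ≤ e^{𝓛⁹}` for `k ≤ 6561 = 3⁸` and `𝓛 ≥ 3` (`𝓛^k ≤ e^{k𝓛}`, `k𝓛 ≤ 𝓛⁹`).
[cite: Zhang2022LandauSiegel, §2 (2.6)] -/
private theorem ell_pow_le_exp_ell9 {L : ℝ} (hL : 3 ≤ L) {k : ℕ} (hk : k ≤ 6561) :
    L ^ k ≤ Real.exp (L ^ 9) := by
  have hL0 : 0 < L := by linarith
  have hLe : L ≤ Real.exp L := by linarith [Real.add_one_le_exp L]
  have h8 : (3 : ℝ) ^ 8 ≤ L ^ 8 := pow_le_pow_left₀ (by norm_num) hL 8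
  calc L ^ k ≤ Real.exp L ^ k := pow_le_pow_left₀ hL0.le hLe k
    _ = Real.exp (k * L) := by rw [← Real.exp_nat_mul]
    _ ≤ Real.exp (L ^ 9) := by
        refine Real.exp_le_exp.mpr ?_
        have hk' : (k : ℝ) ≤ 6561 := by exact_mod_cast hk
        have : L ^ 9 = L ^ 8 * L := by ring
        rw [this]; nlinarith

/-- **`|Z(s,χψ)⁻¹| ≤ e⁸`** on `|σ − ½| ≤ α`, `|t − 2πt₀| ≤ 𝓛₁ + 1` (`D ≥ 3`, `χ` primitive, `𝓛 ≥ 80`):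
`χψ` is primitive mod `Dp`, `|Z(½+it)| = 1`, and the Stirling bound for `Z′/Z` integrated horizontally
(`exp_neg_le_norm_Zfac`) gives `|Z|⁻¹ ≤ exp(|σ−½|(log(Dpt/2π) + 14/t)) ≤ exp(α(2𝓛⁹ + 1)) ≤ e⁸`.
[cite: Zhang2022LandauSiegel, §2 (2.5); §5 Lemma 5.1] -/
theorem norm_inv_Zpc_le_exp8 [NeZero D] {χ : DirichletCharacter ℂ D} (hD : 3 ≤ D)
    (hχ : χ.IsPrimitive) (h80 : 80 ≤ ell D) (x : Chr D) {s : ℂ}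
    (hσ : |s.re - 1 / 2| ≤ alpha D) (ht : |s.im - 2 * π * t0 D| ≤ ell1 D + 1) :
    ‖(Zpc χ x s)⁻¹‖ ≤ Real.exp 8 := by
  have hprim := psiChiPrimitive_holds D χ x hD hχ
  have hL1 : 1 ≤ ell D := by linarith
  have hL3 : 3 ≤ ell D := by linarith
  have hα : alpha D = π / ell D ^ 9 := by rw [alpha, bigP, Real.log_exp]
  have hL9 : 0 < ell D ^ 9 := by positivity
  have hα0 : 0 < alpha D := by rw [hα]; positivity
  have hα100 : alpha D ≤ 1 / 100 := by
    have hL2 : ell D ^ 2 ≤ ell D ^ 9 := pow_le_pow_right₀ hL1 (by norm_num)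
    rw [hα, div_le_iff₀ hL9]; nlinarith [Real.pi_lt_four]
  -- the `t`-range
  have ht' : |s.im - 2 * π * ell D ^ 519| ≤ ell D ^ 405 + 1 := by
    have e1 : t0 D = ell D ^ 519 := rfl
    have e2 : ell1 D = ell D ^ 405 := rfl
    rw [← e1, ← e2]; exact ht
  obtain ⟨ht5, ht8, ht200⟩ := trange_of_ell h80 ht'
  have ht4 : 4 ≤ s.im := by linarith
  have ht0 : 0 < s.im := by linarith
  have hσ4 : |s.re - 1 / 2| ≤ 1 / 4 := hσ.trans (by linarith)
  -- the Gauss-factor lower bound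
  have hs : (s.re : ℂ) + s.im * I = s := Complex.re_add_im s
  have hlow := exp_neg_le_norm_Zfac hprim hσ4 ht4
  rw [hs] at hlow
  -- the size of the exponent
  have hp0 : (0 : ℝ) < x.p := by exact_mod_cast x.prime.pos
  have hp2 : (2 : ℝ) ≤ x.p := by exact_mod_cast x.prime.two_le
  have hD3 : (3 : ℝ) ≤ D := by exact_mod_cast hD
  have hD0 : (0 : ℝ) < D := by linarith
  have hk : (((D * x.p : ℕ) : ℝ)) = (D : ℝ) * x.p := by push_cast; ring
  have hP0 : 0 < bigP D := Real.exp_pos _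
  have hlogp : Real.log (x.p : ℝ) ≤ ell D ^ 9 + 1 := by
    have h4 := (p_lt_two_bigP x hL1).le
    calc Real.log (x.p : ℝ) ≤ Real.log (2 * bigP D) := Real.log_le_log hp0 h4
      _ = Real.log 2 + ell D ^ 9 := by rw [Real.log_mul two_ne_zero hP0.ne', bigP, Real.log_exp]
      _ ≤ ell D ^ 9 + 1 := by linarith [Real.log_two_lt_d9]
  have hlogD : Real.log (D : ℝ) = ell D := rfl
  have hlogt : Real.log s.im ≤ 3 + 519 * ell D := by
    have h1 : Real.log s.im ≤ Real.log (8 * ell D ^ 519) := Real.log_le_log ht0 ht8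
    rw [Real.log_mul (by norm_num) (by positivity), Real.log_pow] at h1
    have h8 : Real.log 8 ≤ 3 := by
      have : Real.log 8 = 3 * Real.log 2 := by
        rw [show (8 : ℝ) = 2 ^ 3 by norm_num, Real.log_pow]; norm_num
      rw [this]; linarith [Real.log_two_lt_d9]
    have hLL : Real.log (ell D) ≤ ell D :=
      (Real.log_le_sub_one_of_pos (by linarith)).trans (by linarith)
    push_cast at h1
    nlinarith
  have hq1 : 1 ≤ (D : ℝ) * x.p * s.im / (2 * π) := by
    rw [le_div_iff₀ (by positivity)]; nlinarith [Real.pi_lt_four]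
  have hlog : |Real.log (((D * x.p : ℕ) : ℝ) * s.im / (2 * π))| ≤ 2 * ell D ^ 9 := by
    rw [hk, abs_of_nonneg (Real.log_nonneg hq1), Real.log_div (by positivity) (by positivity),
      Real.log_mul (by positivity) ht0.ne', Real.log_mul hD0.ne' hp0.ne', hlogD]
    have h2π : 0 ≤ Real.log (2 * π) := Real.log_nonneg (by linarith [Real.pi_gt_three])
    have h9L : 520 * ell D + 4 ≤ ell D ^ 9 := by
      have h8 : (3 : ℝ) ^ 8 ≤ ell D ^ 8 := pow_le_pow_left₀ (by norm_num) hL3 8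
      have : ell D ^ 9 = ell D ^ 8 * ell D := by ring
      rw [this]; nlinarith
    linarith
  have h14 : 14 / s.im ≤ 1 := by rw [div_le_iff₀ ht0]; linarith
  have hE : |s.re - 1 / 2| * (|Real.log (((D * x.p : ℕ) : ℝ) * s.im / (2 * π))| + 14 / s.im) ≤ 8 := by
    calc |s.re - 1 / 2| * (|Real.log (((D * x.p : ℕ) : ℝ) * s.im / (2 * π))| + 14 / s.im)
        ≤ (π / ell D ^ 9) * (2 * ell D ^ 9 + 1) := by
          rw [← hα]
          exact mul_le_mul hσ (by linarith) (by positivity) hα0.le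
      _ = 2 * π + π / ell D ^ 9 := by field_simp
      _ ≤ 8 := by
          have : π / ell D ^ 9 ≤ 1 := by
            rw [div_le_iff₀ hL9]
            have : (3 : ℝ) ^ 9 ≤ ell D ^ 9 := pow_le_pow_left₀ (by norm_num) hL3 9
            nlinarith [Real.pi_lt_four]
          nlinarith [Real.pi_lt_d2]
  rw [norm_inv]
  calc ‖Zpc χ x s‖⁻¹
      ≤ (Real.exp (-(|s.re - 1 / 2| *
          (|Real.log (((D * x.p : ℕ) : ℝ) * s.im / (2 * π))| + 14 / s.im))))⁻¹ :=
        inv_anti₀ (Real.exp_pos _) hlow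
    _ = Real.exp (|s.re - 1 / 2| *
          (|Real.log (((D * x.p : ℕ) : ℝ) * s.im / (2 * π))| + 14 / s.im)) := by
        rw [Real.exp_neg, inv_inv]
    _ ≤ Real.exp 8 := Real.exp_le_exp.mpr hE

/-- The convexity/Stirling size of `L(s + ib, ψ)` on the boundary zone: for `ψ ∈ Ψ`, `|b| ≤ 1`,
`|σ − ½| ≤ ¼`, `|t − 2πt₀| ≤ 𝓛₁ + 1`, `𝓛 ≥ 80`: `|L(s+ib,ψ)| ≤ 4p³ζ(5/4)(9𝓛⁵¹⁹)³` (the tree's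
`StripGrowth.norm_LFunction_le_of_abs_re_le` with `A = 1`; copy of the private lemma of
`Section8Eq81bEdge`). [cite: Zhang2022LandauSiegel, §8 p. 43] -/
theorem norm_LFunction_shift_le_zone (h80 : 80 ≤ ell D) (x : Chr D) {s : ℂ} {b : ℝ}
    (hb : |b| ≤ 1) (hσ : |s.re - 1 / 2| ≤ 1 / 4) (ht : |s.im - 2 * π * t0 D| ≤ ell1 D + 1) :
    ‖x.ψ.LFunction (s + (b : ℂ) * I)‖ ≤
      4 * (x.p : ℝ) ^ 3 * (∑' n : ℕ, ((n + 1 : ℕ) : ℝ) ^ (-(5 / 4 : ℝ))) * (9 * ell D ^ 519) ^ 3 := by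
  have hre : (s + (b : ℂ) * I).re = s.re := by simp
  have him : (s + (b : ℂ) * I).im = s.im + b := by simp
  rw [ell1, t0] at ht
  obtain ⟨ht5, ht8, ht200⟩ := trange_of_ell h80 ht
  have hL1 : 1 ≤ ell D := by linarith
  have h519 : ell D ≤ ell D ^ 519 := by
    calc ell D = ell D ^ 1 := (pow_one _).symm
      _ ≤ ell D ^ 519 := pow_le_pow_right₀ hL1 (by norm_num)
  obtain ⟨hb1, hb2⟩ := abs_le.mp hb
  obtain ⟨hs1, hs2⟩ := abs_le.mp hσ
  have hσ1 : |(s + (b : ℂ) * I).re| ≤ ((1 : ℕ) : ℝ) := by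
    rw [hre, Nat.cast_one, abs_le]; constructor <;> linarith
  have him152 : 38 * (((1 : ℕ) : ℝ) + 1) ^ 2 ≤ |(s + (b : ℂ) * I).im| := by
    rw [him, Nat.cast_one, abs_of_pos (by linarith)]; norm_num; linarith
  have h := StripGrowth.norm_LFunction_le_of_abs_re_le x.prim x.p_ne_one (A := 1) le_rfl hσ1 him152
  have him9 : |(s + (b : ℂ) * I).im| + ((1 : ℕ) : ℝ) + 1 ≤ 9 * ell D ^ 519 := by
    rw [him, Nat.cast_one, abs_of_pos (by linarith)]; linarith
  have hZ : 0 ≤ ∑' n : ℕ, ((n + 1 : ℕ) : ℝ) ^ (-(5 / 4 : ℝ)) := tsum_nonneg fun n => by positivity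
  have hi0 : 0 ≤ |(s + (b : ℂ) * I).im| + ((1 : ℕ) : ℝ) + 1 := by positivity
  calc ‖x.ψ.LFunction (s + (b : ℂ) * I)‖
      ≤ 4 * (x.p : ℝ) ^ (1 + 2) * (∑' n : ℕ, ((n + 1 : ℕ) : ℝ) ^ (-(5 / 4 : ℝ))) *
          (|(s + (b : ℂ) * I).im| + ((1 : ℕ) : ℝ) + 1) ^ (1 + 2) := h
    _ ≤ 4 * (x.p : ℝ) ^ 3 * (∑' n : ℕ, ((n + 1 : ℕ) : ℝ) ^ (-(5 / 4 : ℝ))) * (9 * ell D ^ 519) ^ 3 := by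
        rw [show (1 : ℕ) + 2 = 3 from rfl]
        gcongr

end Sizes

/-! ### C. The numerator `G₁(s) = Z(s,χψ)⁻¹L(s+β₂,ψ)B(s,ψ)K(1−s−β₃,ψ̄)` of `𝔨₁ω/(L(s+β₁)/L(s))` -/

section GOne

variable (c' : ℝ) {D : ℕ} [NeZero D] (χ : DirichletCharacter ℂ D) (x : Chr D)

/-- `𝔨₁(s,ψ)ω(s) = (L(s+β₁,ψ)/L(s,ψ))·G₁(s)·ω(s)` with `G₁ = Z(s,χψ)⁻¹L(s+β₂)BK(1−s−β₃,ψ̄)` (exact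
algebra of the display `Z22:§15.u001`). [cite: Zhang2022LandauSiegel, §15 p. 79, tex L3994] -/
theorem frakk1_mul_omega_eq (s : ℂ) :
    frakk1 c' χ x s * omegaW D s =
      x.ψ.LFunction (s + beta1 c' D) / x.ψ.LFunction s *
        ((Zpc χ x s)⁻¹ * x.ψ.LFunction (s + beta2 c' D) * Bpoly χ x s *
          Kchar D (psiBarFn x) (1 - s - beta3 c' D)) * omegaW D s := by
  simp only [frakk1, div_eq_mul_inv]; ring

/-- `𝔨₁*(ρ,ψ)ω(ρ) = (L(ρ+β₁,ψ)/L′(ρ,ψ))·G₁(ρ)·ω(ρ)` (exact algebra of (13.4)).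
[cite: Zhang2022LandauSiegel, §13 (13.4) p. 74] -/
theorem kstar1_mul_omega_eq (ρ : ℂ) :
    kstar1 c' χ x ρ * omegaW D ρ =
      x.ψ.LFunction (ρ + beta1 c' D) / deriv x.ψ.LFunction ρ *
        ((Zpc χ x ρ)⁻¹ * x.ψ.LFunction (ρ + beta2 c' D) * Bpoly χ x ρ *
          Kchar D (psiBarFn x) (1 - ρ - beta3 c' D)) * omegaW D ρ := by
  simp only [kstar1, div_eq_mul_inv]; ring

/-- `G₁` is holomorphic on the upper half-plane (`D ≥ 3`, `χ` primitive: `χψ` primitive mod `Dp`, so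
`Z(·,χψ)` is analytic and zero-free on `{Im s > 0}`; `L(·,ψ)`, `B`, `K` entire).
[cite: Zhang2022LandauSiegel, §15 p. 79; §2 (2.5)] -/
theorem differentiableOn_G1 (hD : 3 ≤ D) (hχ : χ.IsPrimitive) :
    DifferentiableOn ℂ (fun s => (Zpc χ x s)⁻¹ * x.ψ.LFunction (s + beta2 c' D) * Bpoly χ x s *
      Kchar D (psiBarFn x) (1 - s - beta3 c' D)) {s : ℂ | 0 < s.im} := by
  intro s hs
  have hprim := psiChiPrimitive_holds D χ x hD hχ
  have hZ : DifferentiableAt ℂ (fun s => (Zpc χ x s)⁻¹) s :=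
    (GammaFactor.differentiableAt_Zfac (psiChi χ x) hs).inv (GammaFactor.Zfac_ne_zero hprim hs)
  have hL : Differentiable ℂ x.ψ.LFunction := DirichletCharacter.differentiable_LFunction x.ψ_ne_one
  have h2 : DifferentiableAt ℂ (fun s => x.ψ.LFunction (s + beta2 c' D)) s :=
    (hL.comp (differentiable_id.add_const _)) s
  have hB : DifferentiableAt ℂ (Bpoly χ x) s := Typed.Section17.differentiable_Bpoly χ x s
  have hK : DifferentiableAt ℂ (fun s => Kchar D (psiBarFn x) (1 - s - beta3 c' D)) s :=
    ((Step16u010.differentiable_Kchar (psiBarFn x)).comp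
      (((differentiable_const _).sub differentiable_id).sub_const _)) s
  exact (((hZ.mul h2).mul hB).mul hK).differentiableWithinAt

/-- **The size of `G₁` on the boundary zone**: for `D ≥ 3`, `χ` primitive, `𝓛 ≥ 80`, `𝓛 ≥ 5π|c′| + 1`,
`ψ ∈ Ψ`, `|σ − ½| ≤ α`, `|t − 2πt₀| ≤ 𝓛₁ + 1`:
`|G₁(s)| ≤ e⁸ · 4p³ζ(5/4)(9𝓛⁵¹⁹)³ · (1+|ι₂|)(|ι₃|+|ι₄|)(P+1)² · (2Pt₀+1) ≤ A₁·e^{8𝓛⁹}` with the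
absolute `A₁ = e⁸·32·729·ζ(5/4)·4(1+|ι₂|)(|ι₃|+|ι₄|)·3`. [cite: Zhang2022LandauSiegel, §15 p. 80] -/
theorem norm_G1_le (hD : 3 ≤ D) (hχ : χ.IsPrimitive) (h80 : 80 ≤ ell D)
    (hc : 5 * π * |c'| + 1 ≤ ell D) {s : ℂ}
    (hσ : |s.re - 1 / 2| ≤ alpha D) (ht : |s.im - 2 * π * t0 D| ≤ ell1 D + 1) :
    ‖(Zpc χ x s)⁻¹ * x.ψ.LFunction (s + beta2 c' D) * Bpoly χ x s *
        Kchar D (psiBarFn x) (1 - s - beta3 c' D)‖ ≤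
      (Real.exp 8 * (32 * 729 * ∑' n : ℕ, ((n + 1 : ℕ) : ℝ) ^ (-(5 / 4 : ℝ))) *
        (4 * ((1 + ‖iota2‖) * (‖iota3‖ + ‖iota4‖))) * 3) * Real.exp (8 * ell D ^ 9) := by
  have hL1 : 1 ≤ ell D := by linarith
  have hL2 : 2 ≤ Real.log D := by rw [← ell]; linarith
  have hL3 : 3 ≤ ell D := by linarith
  have hℓ0 : 0 < ell D := by linarith
  obtain ⟨hα0, hα, hα100, -⟩ := Typed.Section17.alpha_sizes171 (C := 0) h80
    (by rw [abs_zero, mul_zero, zero_add]; exact hL1)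
  obtain ⟨-, hb2, -, -, -, -⟩ := shift_sizes_of_ell h80 hc
  obtain ⟨-, hβ2, hβ3⟩ := beta_eq_b_mul_I c' D
  have hσ0 : 0 ≤ s.re := by have := abs_le.mp hσ; linarith
  have hσ4 : |s.re - 1 / 2| ≤ 1 / 4 := hσ.trans (by linarith)
  set Z : ℝ := ∑' n : ℕ, ((n + 1 : ℕ) : ℝ) ^ (-(5 / 4 : ℝ)) with hZ
  have hZ0 : 0 ≤ Z := tsum_nonneg fun n => by positivity
  set cB : ℝ := (1 + ‖iota2‖) * (‖iota3‖ + ‖iota4‖) with hcB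
  have hcB0 : 0 ≤ cB := by positivity
  have hP : bigP D = Real.exp (ell D ^ 9) := rfl
  have hP0 : 0 < bigP D := Real.exp_pos _
  have hP1 : 1 ≤ bigP D := by rw [hP]; exact Real.one_le_exp (by positivity)
  -- the four factors
  have hZf : ‖(Zpc χ x s)⁻¹‖ ≤ Real.exp 8 := norm_inv_Zpc_le_exp8 hD hχ h80 x hσ ht
  have hLf : ‖x.ψ.LFunction (s + beta2 c' D)‖ ≤ 4 * (x.p : ℝ) ^ 3 * Z * (9 * ell D ^ 519) ^ 3 := by
    rw [hβ2]
    exact norm_LFunction_shift_le_zone h80 x (hb2.trans (by linarith)) hσ4 ht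
  have hBf : ‖Bpoly χ x s‖ ≤ cB * (bigP D + 1) ^ 2 :=
    Typed.Section17.norm_Bpoly_le_trivial χ x hL2 hσ0
  have hKf : ‖Kchar D (psiBarFn x) (1 - s - beta3 c' D)‖ ≤ 2 * bigP D * t0 D + 1 := by
    refine norm_Kchar_psiBar_le x hℓ0 ?_
    have : (1 - s - beta3 c' D).re = 1 - s.re := by
      rw [hβ3]; simp
    rw [this]; have := abs_le.mp hσ; linarith
  -- exponential envelopes of the factors
  have hp0 : (0 : ℝ) ≤ x.p := by positivity
  have hp3 : (x.p : ℝ) ^ 3 ≤ 8 * Real.exp (3 * ell D ^ 9) := by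
    calc (x.p : ℝ) ^ 3 ≤ (2 * bigP D) ^ 3 := pow_le_pow_left₀ hp0 (p_lt_two_bigP x hL1).le 3
      _ = 8 * Real.exp (3 * ell D ^ 9) := by rw [mul_pow, hP, ← Real.exp_nat_mul]; norm_num
  have hℓ1557 : (9 * ell D ^ 519) ^ 3 ≤ 729 * Real.exp (ell D ^ 9) := by
    rw [mul_pow, ← pow_mul]
    have h := ell_pow_le_exp_ell9 hL3 (k := 519 * 3) (by norm_num)
    nlinarith
  have hP2 : (bigP D + 1) ^ 2 ≤ 4 * Real.exp (2 * ell D ^ 9) := by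
    calc (bigP D + 1) ^ 2 ≤ (2 * bigP D) ^ 2 := pow_le_pow_left₀ (by linarith) (by linarith) 2
      _ = 4 * Real.exp (2 * ell D ^ 9) := by rw [mul_pow, hP, ← Real.exp_nat_mul]; norm_num
  have ht0e : t0 D ≤ Real.exp (ell D ^ 9) := ell_pow_le_exp_ell9 hL3 (k := 519) (by norm_num)
  have hK2 : 2 * bigP D * t0 D + 1 ≤ 3 * Real.exp (2 * ell D ^ 9) := by
    have h1 : bigP D * t0 D ≤ Real.exp (ell D ^ 9) * Real.exp (ell D ^ 9) := by
      rw [hP]; exact mul_le_mul_of_nonneg_left ht0e (Real.exp_pos _).le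
    rw [← Real.exp_add, show ell D ^ 9 + ell D ^ 9 = 2 * ell D ^ 9 by ring] at h1
    have h2 : (1 : ℝ) ≤ Real.exp (2 * ell D ^ 9) := Real.one_le_exp (by positivity)
    linarith
  -- assemble
  have hLf' : ‖x.ψ.LFunction (s + beta2 c' D)‖ ≤ (32 * 729 * Z) * Real.exp (4 * ell D ^ 9) := by
    refine hLf.trans ?_
    calc 4 * (x.p : ℝ) ^ 3 * Z * (9 * ell D ^ 519) ^ 3
        ≤ 4 * (8 * Real.exp (3 * ell D ^ 9)) * Z * (729 * Real.exp (ell D ^ 9)) := by gcongr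
      _ = (32 * 729 * Z) * (Real.exp (3 * ell D ^ 9) * Real.exp (ell D ^ 9)) := by ring
      _ = (32 * 729 * Z) * Real.exp (4 * ell D ^ 9) := by
          rw [← Real.exp_add]; ring_nf
  have hBf' : ‖Bpoly χ x s‖ ≤ (4 * cB) * Real.exp (2 * ell D ^ 9) := by
    refine hBf.trans ?_
    calc cB * (bigP D + 1) ^ 2 ≤ cB * (4 * Real.exp (2 * ell D ^ 9)) :=
          mul_le_mul_of_nonneg_left hP2 hcB0
      _ = (4 * cB) * Real.exp (2 * ell D ^ 9) := by ring
  have hKf' := hKf.trans hK2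
  rw [norm_mul, norm_mul, norm_mul]
  calc ‖(Zpc χ x s)⁻¹‖ * ‖x.ψ.LFunction (s + beta2 c' D)‖ * ‖Bpoly χ x s‖ *
        ‖Kchar D (psiBarFn x) (1 - s - beta3 c' D)‖
      ≤ Real.exp 8 * ((32 * 729 * Z) * Real.exp (4 * ell D ^ 9)) *
          ((4 * cB) * Real.exp (2 * ell D ^ 9)) * (3 * Real.exp (2 * ell D ^ 9)) := by
        gcongr
    _ = (Real.exp 8 * (32 * 729 * Z) * (4 * cB) * 3) *
          (Real.exp (4 * ell D ^ 9) * Real.exp (2 * ell D ^ 9) * Real.exp (2 * ell D ^ 9)) := by ring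
    _ = (Real.exp 8 * (32 * 729 * Z) * (4 * cB) * 3) * Real.exp (8 * ell D ^ 9) := by
        rw [← Real.exp_add, ← Real.exp_add]; ring_nf

end GOne

/-! ### D. `Z22:§15.u002` from Proposition 2.2, and the eventual forms of u002 and (15.3) -/

set_option maxHeartbeats 400000 in
/-- **`Z22:§15.u002` DISCHARGED modulo Proposition 2.2**: for `c′ ≥ 0` with `Skeleton.Prop22 c′`,
"Similar to (8.1), for `ψ ∈ Ψ₁` we have `Σ_{ρ∈𝔷(ψ)} 𝔨₁*(ρ,ψ)ω(ρ) = I₂⁺(ψ) − I₂⁻(ψ) + O(ε)`" with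
`ε = e^{−𝓛¹⁰/8}` and an absolute implied constant — the abstract (8.1) engine
(`lratio_residue_edge_of_prop22`, growth exponent `κ = 9`) at `G = G₁`
(`differentiableOn_G1`, `norm_G1_le`: `A₁e^{8𝓛⁹} ≤ e^{9𝓛⁹}` once `𝓛 ≥ A₁`).
[cite: Zhang2022LandauSiegel, §15 p. 80, tex L3999–L4005] -/
theorem step15_u002_of_prop22 {c' : ℝ} (hc' : 0 ≤ c') (h22 : Prop22 c') : Step15_u002 c' := by
  obtain ⟨C', D₀, hC⟩ := lratio_residue_edge_of_prop22 hc' h22 9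
  set A₁ : ℝ := Real.exp 8 * (32 * 729 * ∑' n : ℕ, ((n + 1 : ℕ) : ℝ) ^ (-(5 / 4 : ℝ))) *
    (4 * ((1 + ‖iota2‖) * (‖iota3‖ + ‖iota4‖))) * 3 with hA₁
  set L₀ : ℝ := max 80 (max (5 * π * |c'| + 1) A₁) with hL₀
  refine ⟨1 / 8, by norm_num, C', max D₀ (max 3 ⌈Real.exp L₀⌉₊), ?_⟩
  intro D _ χ hD hq hp hA x hx
  have hD₀ : D₀ ≤ D := le_trans (le_max_left _ _) hD
  have hD3 : 3 ≤ D := le_trans (le_max_left _ _) (le_trans (le_max_right _ _) hD)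
  have hDℓ : ⌈Real.exp L₀⌉₊ ≤ D := le_trans (le_max_right _ _) (le_trans (le_max_right _ _) hD)
  have hL : L₀ ≤ ell D := Section4.le_ell_of_ceil_exp_le hDℓ
  have h80 : 80 ≤ ell D := (le_max_left _ _).trans hL
  have hcL : 5 * π * |c'| + 1 ≤ ell D := ((le_max_left _ _).trans (le_max_right _ _)).trans hL
  have hAL : A₁ ≤ ell D := ((le_max_right _ _).trans (le_max_right _ _)).trans hL
  have hL1 : 1 ≤ ell D := by linarith
  -- the numerator `G₁`
  set G : ℂ → ℂ := fun s => (Zpc χ x s)⁻¹ * x.ψ.LFunction (s + beta2 c' D) * Bpoly χ x s *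
    Kchar D (psiBarFn x) (1 - s - beta3 c' D) with hG
  have hGd : DifferentiableOn ℂ G {s : ℂ | 0 < s.im} := differentiableOn_G1 c' χ x hD3 hp
  have hA₁le : A₁ ≤ Real.exp (ell D ^ 9) := by
    have h9 : ell D ≤ ell D ^ 9 := by
      calc ell D = ell D ^ 1 := (pow_one _).symm
        _ ≤ ell D ^ 9 := pow_le_pow_right₀ hL1 (by norm_num)
    have he : ell D ^ 9 ≤ Real.exp (ell D ^ 9) := by linarith [Real.add_one_le_exp (ell D ^ 9)]
    linarith
  have hGb : ∀ s : ℂ, |s.re - 1 / 2| ≤ alpha D → ell1 D - 1 ≤ |s.im - 2 * π * t0 D| →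
      |s.im - 2 * π * t0 D| ≤ ell1 D + 1 / 4 → ‖G s‖ ≤ Real.exp (9 * ell D ^ 9) := by
    intro s hσ _ ht2
    have h := norm_G1_le c' χ x hD3 hp h80 hcL hσ (ht2.trans (by linarith))
    refine h.trans ?_
    calc A₁ * Real.exp (8 * ell D ^ 9) ≤ Real.exp (ell D ^ 9) * Real.exp (8 * ell D ^ 9) :=
          mul_le_mul_of_nonneg_right hA₁le (Real.exp_pos _).le
      _ = Real.exp (9 * ell D ^ 9) := by rw [← Real.exp_add]; ring_nf
  have key := hC D χ hD₀ hq hp hA x hx G hGd hGb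
  -- rewrite the three pieces of the node into the engine's shape
  have hsum : (∑ ρ ∈ finsetOf (zeroSet D x), kstar1 c' χ x ρ * omegaW D ρ) =
      ∑ ρ ∈ finsetOf (zeroSet D x),
        x.ψ.LFunction (ρ + beta1 c' D) / deriv x.ψ.LFunction ρ * G ρ * omegaW D ρ :=
    Finset.sum_congr rfl fun ρ _ => kstar1_mul_omega_eq c' χ x ρ
  have hfun : (fun s => frakk1 c' χ x s * omegaW D s) =
      fun s => x.ψ.LFunction (s + beta1 c' D) / x.ψ.LFunction s * G s * omegaW D s :=
    funext fun s => frakk1_mul_omega_eq c' χ x s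
  have hexp : Real.exp (-(1 / 8) * ell D ^ 10) = Real.exp (-(ell D ^ 10 / 8)) := by
    congr 1; ring
  rw [hsum, I2pm, I2pm, hfun, hexp]
  exact key

/-- **`Z22:§15.u002` holds for every `c′ ≥ c₀`** (Proposition 2.2 is a tree theorem eventually in `c′`,
`Skeleton.prop22_eventually`). [cite: Zhang2022LandauSiegel, §15 p. 80, tex L3999] -/
theorem step15_u002_eventually : ∃ c₀ : ℝ, 0 ≤ c₀ ∧ ∀ c' : ℝ, c₀ ≤ c' → Step15_u002 c' := by
  obtain ⟨c₀, hc₀, h⟩ := prop22_eventually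
  exact ⟨c₀, hc₀, fun c' hc' => step15_u002_of_prop22 (hc₀.trans hc') (h c' hc')⟩

/-- **(15.3) holds for every `c′ ≥ c₀`**: "Hence `Φ₁ = Σ_{ψ∈Ψ₁}(I₂⁺(ψ) − I₂⁻(ψ)) + O(ε)`" — the node
`Typed.Section15A.Eq15_3 c′`, by the tree's edge `eq15_3_of_u002` (summation over `Ψ₁`,
`#Ψ₁ ≤ 𝔓 ≤ 2P²`). [cite: Zhang2022LandauSiegel, §15 (15.3) p. 80, tex L4007] -/
theorem eq15_3_eventually : ∃ c₀ : ℝ, 0 ≤ c₀ ∧ ∀ c' : ℝ, c₀ ≤ c' → Eq15_3 c' := by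
  obtain ⟨c₀, hc₀, h⟩ := step15_u002_eventually
  exact ⟨c₀, hc₀, fun c' hc' => eq15_3_of_u002 c' (h c' hc')⟩

end Literature.NumberTheory.LFunctions.Zhang2022.Typed.Section15A
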